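import Mathlib

/-!
# ExteriorAlgebraFinite — the exterior algebra of a finite-dimensional space is finite-dimensional

Mathlib infers `Module.Finite K (⋀[K]^n M)` for each exterior power of a finite-dimensional `M`, but not
`Module.Finite K (ExteriorAlgebra K M)` for the whole algebra (farm probe of this seat, 2026-08-25). The Tier-6
interface (route/t6-lead-lean/T6Interface.lean v0) takes `HB K := ExteriorAlgebra ℚ (Fin 4 → K)` as the
cohomology ring of the corner product, and the projector lemmas of the bridge (`BridgeSeparation.
exists_aeval_proj_of_separation`, `BridgeCoprime.exists_aeval_proj`) need `[FiniteDimensional ℚ V]`.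

This file supplies the instance: the graded decomposition `ExteriorAlgebra K M = ⨁_i ⋀[K]^i M`
(`ExteriorAlgebra.gradedAlgebra`) has only the pieces `i ≤ finrank K M` non-zero
(`exteriorPower.finrank_eq`: `finrank (⋀^i M) = (finrank M).choose i`), so `⊤` is a finite supremum of
finitely generated submodules. The dimension is `2 ^ finrank K M` (`finrank_exteriorAlgebra`).
-/

namespace Summit.Ventures.HodgeRepro2.ExteriorAlgebraFinite

open Module

variable (K : Type*) [Field K] (M : Type*) [AddCommGroup M] [Module K M] [FiniteDimensional K M]

/-- The exterior powers of degree above the dimension vanish. -/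
theorem exteriorPower_eq_bot_of_lt {i : ℕ} (hi : finrank K M < i) : (⋀[K]^i M) = ⊥ := by
  rw [← Submodule.finrank_eq_zero, exteriorPower.finrank_eq]
  exact Nat.choose_eq_zero_of_lt hi

omit [FiniteDimensional K M] in
/-- The graded pieces exhaust the algebra: `⨆ i, ⋀[K]^i M = ⊤`. -/
theorem iSup_exteriorPower_eq_top : (⨆ i : ℕ, ⋀[K]^i M) = ⊤ := by
  classical
  haveI : GradedAlgebra (fun i : ℕ => ⋀[K]^i M) := ExteriorAlgebra.gradedAlgebra K M
  exact (DirectSum.Decomposition.isInternal (fun i : ℕ => ⋀[K]^i M)).submodule_iSup_eq_top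

/-- Only the pieces of degree `≤ finrank K M` are needed. -/
theorem iSup_exteriorPower_le_finrank_eq_top :
    (⨆ i : Fin (finrank K M + 1), ⋀[K]^(i : ℕ) M) = ⊤ := by
  rw [← iSup_exteriorPower_eq_top K M]
  apply le_antisymm
  · exact iSup_le fun i => le_iSup (fun j : ℕ => ⋀[K]^j M) (i : ℕ)
  · refine iSup_le fun i => ?_
    by_cases hi : i ≤ finrank K M
    · exact le_iSup (fun j : Fin (finrank K M + 1) => ⋀[K]^(j : ℕ) M) ⟨i, Nat.lt_succ_of_le hi⟩
    · rw [exteriorPower_eq_bot_of_lt K M (Nat.lt_of_not_le hi)]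
      exact bot_le

/-- **The exterior algebra of a finite-dimensional space is finite-dimensional.** -/
instance finite_exteriorAlgebra : Module.Finite K (ExteriorAlgebra K M) := by
  rw [Module.finite_def, ← iSup_exteriorPower_le_finrank_eq_top K M]
  exact Submodule.fg_iSup _ fun i => Module.Finite.iff_fg.1 inferInstance

/-- `FiniteDimensional` spelling of the instance above. -/
theorem finiteDimensional_exteriorAlgebra : FiniteDimensional K (ExteriorAlgebra K M) :=
  finite_exteriorAlgebra K M

end Summit.Ventures.HodgeRepro2.ExteriorAlgebraFinite
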